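import Literature.MathematicalPhysics.QuantumFieldTheory.Balaban1983to89.B6Ineq288TwoScaleV1
import Literature.MathematicalPhysics.QuantumFieldTheory.Balaban1983to89.B6BlockDecayGLapBridgeV1
import Literature.MathematicalPhysics.QuantumFieldTheory.Balaban1983to89.B6Cor28TwoScaleV1

/-!
# `Balaban1983to89.B6Eq292MemberTwoScaleV1` — T. Bałaban, *Propagators and renormalization transformations for lattice gauge theories. II*,
# Commun. Math. Phys. **96** (1984) 223–250 [Balaban1984PropagatorsII], (2.92) p. 239, LINES 1–2, FOR THE GENUINE TWO-SCALE MEMBER: the commutator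
# `h_□(Δ_□ + Q*aQ) − (Δ_□ + Q*aQ)h_□` of the member operator of `tsV1` on the member torus, in the `hdec` shape of the (2.134) files — with the
# lattice Weitzenböck identity `∂*∂ + ∂∂* = Σ_ν∇_ν*∇_ν` ([4] (1.21)) for the V1 vector Laplacian proved on the way

statement-level skeleton of published theorems with citation tags; proofs where landed; nothing here is a claim about the Yang–Mills mass gap

PDF held: `paper:balaban1984-cmp96-propagators-rt-ii` (journal page = PDF page + 222); p. 239 [PDF 17], p. 229 [PDF 7] ((2.39)), p. 247 [PDF 25]
read AS IMAGES on the ×2 renders `run/shared/lean/pub/pub-balaban/b2b-balaban-ref1/pages/1984-cmp96-propagators-rt-II/` by this seat (2026-08-23);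
`paper:balaban1984-cmp95-propagators-rt-i` ([4] = [Balaban1984PropagatorsI]; journal page = PDF page + 16), p. 21 (1.21).

PRINT (verbatim).  p. 239: *"G_□ = (Δ − ∂P_□∂* + Q*aQ)⁻¹. (2.90) … Using the formulas (1.126)–(1.128), we get Δ_aG₀ = I − Σ_{□,□′∈𝒟} K_{□,□′}G_{□′}h_{□′} = I − R,
(2.91) where (K_{□,□}A)_μ(x) = Σ_{b∈st(x)} (∂h_□)(b)(∂A_μ)(b) − (Δh_□)(x)A_μ(x) + a(L^jη)^{−2}(S_j*(∂h_□)Q_jA)_μ(x) − a(L^jη)^{−2}(Q_j*S_j(∂h_□)A)_μ(x)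
+ (ζ_□(∂P∂* − ∂P_□∂*)h_□A)_μ(x) + (ζ_□P_{□,1}(∂h_□)A)_μ(x). (2.92) if x ∈ B^j(Λ_j) (we replace the index j above by j + 1 if x ∈ B^{j+1}(Λ_{j+1}))"*.
[4] p. 21 (1.21): *"⟨∂A, ∂A⟩ = Σ_μ⟨A_μ, ΔA_μ⟩ − ⟨∂*A, ∂*A⟩ where Δ is η-lattice Laplace operator for scalar functions and ∂* is the divergence operator"*.

CITATION HEADER (lean-in-tree rule) — WHAT IS REPRODUCED.  Phase-2 file of the `lit-balaban` typed skeleton (HOME `run/shared/lean/pub/lit-balaban/`),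
seat **p22 gen 18** (free-target protocol G.5-34(d), TAKING #2, HOME/STATUS.md 2026-08-23T01:3xZ; B6 fold owner r03, referee ref-4); SKELETON rows
**B6.Eq2.92** × **B6.Eq2.39** × **B6.Prop2.6** (cells only; decls of record untouched: (2.39)/(2.92) line 1 for scalar site functions is r03 gen 2's
`…B6Eq239Commutator.laplace_part`, the abstract (2.91)/(2.92) ring algebra is p02's `…B6Eq291Generator`).  THIS FILE = the member-side input
*«hdec for the concrete M_□ = Δ + Q*aQ on vector fields»* of the (2.134) files (p38's `…B6Ineq2134DiagKLevel.ineq2134_diag_kLevel` /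
`…B6Ineq2134KFamKLevel.h2134_kFam_kLevel`, hypothesis `hdec : mulOp h * Ml − Ml * mulOp h = (Σ_e mulOp (cf e) * E e − mulOp c₀) +
Σ_k mulOp (z k) * (N k * mulOp h − mulOp h * N k)`; B6-CLOSURE.md §5 items 7–9, p38's per-cube list of 2026-08-22T22:40Z item (2)) FOR THE GENUINE
TWO-SCALE MEMBER OPERATOR `Δ_□ + Q*aQ = (tsV1 hc Λ′ w).lapV + Q*aQ` of (2.90) on the member torus (r03's `Ml := ε(Δ_□ + Q*aQ)ρ` before the transplant,
`…B6AgreeLapV1Chart.hinvl_member`), every member of r03's census `TSIdx` (volume, scale `j + 1 ≤ m + K`, `Λ′ ⊂ T^{(j+1)}`, weights).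

THIS FILE.
* §1 **THE LATTICE WEITZENBÖCK IDENTITY ON THE V1 BOND SPACE** ([4] (1.21) as an OPERATOR identity): `∂*∂ + ∂∂* = Σ_ν ∇_ν*∇_ν` —
  `lapV_eq_sum_DadjD`: `dcsE c ∘ dcE c + dE c ∘ dsE c = Σ_ν (c(S_ν⁻¹ − I)) ∘ (c(S_ν − I))` on `ℓ²(bonds of T^{(0)})` at `c = L^j` (every torus of the V1
  calculus, every `j ≤ m + K`), from [4] (1.21) on r02's torus (p21's `…B5Hk163RDiv.form_DstarD` read through r03's transport: `form_DstarD_TV`, gen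
  18's `…B6Ineq288TwoScaleV1.form_graddiv_TV`, gen 15's `…B6BlockDecayGLapBridgeV1.re_Lap_TV`) — the quadratic forms agree (`inner_lapV_eq`), both
  operators are symmetric (`lapV_form`, gen 15's `adjoint_Dop`), polarisation (`LinearMap.IsSymmetric.inner_map_self_eq_zero`); for the member:
  **`lapV_member_eq_lapTS : i.D.lapV = i.lapTS`** (r03's census Laplacian `Σ_λ∇_λ*∇_λ`).
* §2 **LINE 1 OF (2.92) = THE LEIBNIZ RULE FOR `Σ_λ∇_λ*∇_λ` AGAINST A MULTIPLICATION** on the bond functions of the member torus: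
  `leibniz_lapTS`: `h·(ΔA) − Δ(hA) = Σ_λ[(∇_λh)(∇_λA) + (∇_λ*h)(∇_λ*A)] − (Δh)A` (print's *"Σ_{b∈st(x)}(∂h)(b)(∂A_μ)(b) − (Δh)(x)A_μ(x)"*, the sum over
  `st(x)` as forward + backward bond per direction; r03's `laplace_part` is the scalar-site twin) in the operator ring `Module.End ℝ (PBond → ℝ)`.
* §3 **`hdec_member`**: for every member `i` and every `h`,
  `mulOp h * onFun (Δ_□ + Q*aQ) − onFun (Δ_□ + Q*aQ) * mulOp h = (Σ_{e : Fin (d+1) × Bool} mulOp (cf e) * E e − mulOp c₀) + Σ_{k ∈ {()}} mulOp (−1) * (N * mulOp h − mulOp h * N)`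
  with `E (λ, true) = onFun ∇_λ`, `E (λ, false) = onFun ∇_λ*`, `cf e = E e h`, `c₀ = Δh`, `N = onFun (Q*aQ)` — LITERALLY the `hdec` slot (line 2 kept
  as ONE commutator partner `N`, `z ≡ −1`, as the (2.134) files treat the averaging commutators; print expands it through `S_j` of [4] (1.120), the
  tree's `…B6Eq291Generator.gramW_comm`), and the scaled form `hdec_member_smul` (any scalar `κ`, for the unit factor `(c′/L^j)²` of r03's transplant).
* §4 the partner majorants on the member geometry `tsGeo` (p38's conventions): **`ineq2133_DlaG`** — `onFun (∇_λ* ∘ G_□)` has a majorant `A·e^{−δ|y−y′|_T}`,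
  ONE `(δ, A)` for all members and directions (the backward twin of p38's `ineq2133_DG`: `∇_λ*X = −S_λ⁻¹∇_λX`, one fine step moves a block by ≤ 1).
* §5 the line-2 partner **`N = Q*aQ`**: `blockBound_QaQ` (fine bonds ← fine bonds, every rate: gen 17's `Q*` block bound `…B6Cor28TwoScaleV1.blockBound_Q_adjoint`,
  the middle factor `aQ″` — entries `w_iq_i(b)`, `q_i(b) ≤ 1` of range `2L − 1` (`Qpp_adjoint_entry_le`) — and gen 14's `Q_j` (`blockBound_Qv`), composed
  twice without volume factors), **`blockBound_QaQ_scaling`** (ONE rate, ONE constant on `d, L, a₁` for the whole family: `η^{d+1}n^{d+1} = 1` against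
  `a₀n^{d+1} ≤ w ≤ a₁n^{d+1}`), **`ineq2133_QaQ`** (the `hN` shape: `HasMajorant … (onFun (Q*aQ)) (A·e^{−δ|y−y′|_T})` on `tsGeo i R M`).
IMPORTS BY NAME, restating nothing.  THEOREMS ONLY (no `def`, no `def … : Prop`, no new hypothesis); standard axioms.

HONEST SCOPE / DIVERGENCES. (1) The identity of §1 is proved at the lattice factors `c = L^j`, `j ≤ m + K` (all that the members use; it is homogeneous
of degree 2 in `c`). (2) `h` is ANY real function of the fine BONDS of the member torus (print's `h_□(x)` multiplies `A_μ(x)`, i.e. `h(b) = h_□(b₋)`; the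
(1.118) family is p38's `…B6Partition118KLevelFine*`), the coefficients `cf`, `c₀` are the differences of `h` themselves — their sizes `s₁/(M·L^jη)`,
`s₂/(M(L^jη)²)` are the consumer's. (3) The transplant to the global lattice (conjugation through r03's bijective window chart, `h ↦ h ∘ chart`) and
the unit factor `(c′/L^j)²` are r03's (d3)/(d5); §3 passes scalars through. (4) Line 2 is NOT expanded into print's `S_j`-form (it stays one commutator `[N, h]`, bounded by the consumer from `hN` and the Lipschitz data
of `h`); lines 3–4 (`∂P∂*` global vs `∂P_□∂*`, `[∂P_□∂*, h_□]`) are p38's domain-change file and gen 18's `…B6Ineq288TwoScaleV1`. (5) Constants crude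
and ours (rate `1` in §5).  NOT summit progress.  Unit `lit-balaban-p22` (gen 18), 2026-08-23.
-/

noncomputable section

open scoped InnerProductSpace BigOperators Matrix ComplexConjugate
open Finset

namespace Literature.MathematicalPhysics.QuantumFieldTheory.Balaban1983to89.B6Eq292MemberTwoScaleV1

open LatticeFieldCalculus B5SectBStatements B5Eq117TorusCarriers B6SectAOperatorsV1 B6SectCOperators B6SectCTwoScaleV1 B6SectCTwoScaleV1Lattice
  B5Eq118OneStroke
open BalabanImbrieJaffe1984to88.BIJ85AxialPropagator411 (BondSpace)
open B4TorusKernel.MultiPeriod (torusSupNorm torusSupNorm_nonneg)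
open B6LowerBound2153Torus (rep)
open B5Prop11Plancherel (Tor fine)
open B5Prop11Lower (Lap)
open B5Action121 (GradOp)
open B5Hk163RDiv (DstarD)
open B6GOneLevelV1Bridge (TV TV_apply TV_apply_EK bondEK bondEK_apply form_DstarD_TV)
open B6Ineq288TwoScaleV1 (form_graddiv_TV)
open B6BlockDecayGLapBridgeV1 (D_apply Lap_apply re_Lap_TV)
open B6BlockDecayGDivBridgeV1 (adjoint_Dop Dadj_apply)
open B6BlockDecayCalculus (blockBound_comp blockBound_of_entry adjoint_entry torusDist_isPseudoDist torusDist_sumBound)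
open B4Sect5Proof (latticeConst latticeConst_nonneg)
open B6BlockDecayHjCovV1 (card_fiber_src_le)
open B6BlockDecayGtV1 (blockBound_Qv)
open B6Cor28TwoScaleV1 (Qpp_adjoint_entry_le blockBound_Q_adjoint)
open B6BlockDecayHprimeCovV1 (torusDist_blk_unshift_le_one)
open B6Prop26Gluing (mulOp mulOp_apply)
open B6RandomWalk (HasMajorant)
open B6Ineq2133TwoScaleV1 (onFun onFun_apply tsGeo hasMajorant_of_blockBound)
open B6Prop25TwoScaleCensus (TSIdx)
open B6Prop25GradDecayTwoScaleV1 (blockBound_DG_scaling)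

/-! ## §1  `∂*∂ + ∂∂* = Σ_ν ∇_ν*∇_ν` on the V1 bond space ([4] (1.21) as an operator identity) -/

section Weitzenbock

variable {d L m K : ℕ} [NeZero L] {hd : 1 ≤ d + 1} {hL : Odd L ∧ 1 < L} {j : ℕ}
  (hj' : j ≤ (⟨d + 1, L, m, K, hd, hL⟩ : Params).m + (⟨d + 1, L, m, K, hd, hL⟩ : Params).K)

/-- `Ã†(Δ Ã)` (r02's componentwise `Lap`) is `⟨∂A, ∂A⟩ + ⟨∂*A, ∂*A⟩` of the V1 calculus at `c = L^j` — [4] (1.21) on r02's torus (`form_DstarD_TV`: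
`Ã†(Δ − ∂∂ᴴ)Ã = ⟨∂A, ∂A⟩`) plus `Ã†(∂∂ᴴ)Ã = ⟨∂*A, ∂*A⟩` (`form_graddiv_TV`). [cite: Balaban1984PropagatorsI, (1.21) p.21] -/
theorem star_TV_Lap_TV (x : BondSpace (⟨d + 1, L, m, K, hd, hL⟩ : Params)) :
    star (TV hj' x) ⬝ᵥ (Lap (L ^ j) (Mk (⟨d + 1, L, m, K, hd, hL⟩ : Params) j) *ᵥ TV hj' x) =
      ((⟪dcE ((L : ℝ) ^ j) x, dcE ((L : ℝ) ^ j) x⟫_ℝ + ⟪dsE ((L : ℝ) ^ j) x, dsE ((L : ℝ) ^ j) x⟫_ℝ : ℝ) : ℂ) := by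
  have h1 := form_DstarD_TV hj' x
  have h2 := form_graddiv_TV hj' x x
  unfold DstarD at h1
  rw [Matrix.sub_mulVec, dotProduct_sub, sub_eq_iff_eq_add] at h1
  rw [h1]
  change _ + star (TV hj' x) ⬝ᵥ ((GradOp (fine (L ^ j) (Mk (⟨d + 1, L, m, K, hd, hL⟩ : Params) j)) ((L ^ j : ℕ) : ℂ) *
      (GradOp (fine (L ^ j) (Mk (⟨d + 1, L, m, K, hd, hL⟩ : Params) j)) ((L ^ j : ℕ) : ℂ))ᴴ) *ᵥ TV hj' x) = _
  rw [h2]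
  push_cast
  ring

/-- the real part of `Ã†(ΔÃ)` is the V1 pairing `⟨A, Σ_ν∇_ν*∇_νA⟩` (gen 15's dictionary `re_Lap_TV`, summed against the real `Ã`).
[cite: Balaban1984PropagatorsI, (1.21) p.21, (1.18) p.20, dictionary] -/
theorem re_star_TV_Lap_TV (x : BondSpace (⟨d + 1, L, m, K, hd, hL⟩ : Params)) :
    (star (TV hj' x) ⬝ᵥ (Lap (L ^ j) (Mk (⟨d + 1, L, m, K, hd, hL⟩ : Params) j) *ᵥ TV hj' x)).re =
      ⟪x, (∑ ν : Fin (d + 1), ((((L : ℝ) ^ j) • (onE (LinearMap.funLeft ℝ ℝ (fun b : PBond (⟨d + 1, L, m, K, hd, hL⟩ : Params) 0 =>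
          (⟨b.src.unshift ν, b.dir⟩ : PBond (⟨d + 1, L, m, K, hd, hL⟩ : Params) 0))) - LinearMap.id) :
            BondSpace (⟨d + 1, L, m, K, hd, hL⟩ : Params) →ₗ[ℝ] BondSpace (⟨d + 1, L, m, K, hd, hL⟩ : Params))) ∘ₗ
        ((((L : ℝ) ^ j) • (onE (LinearMap.funLeft ℝ ℝ (fun b : PBond (⟨d + 1, L, m, K, hd, hL⟩ : Params) 0 =>
          (⟨b.src.shift ν, b.dir⟩ : PBond (⟨d + 1, L, m, K, hd, hL⟩ : Params) 0))) - LinearMap.id) :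
            BondSpace (⟨d + 1, L, m, K, hd, hL⟩ : Params) →ₗ[ℝ] BondSpace (⟨d + 1, L, m, K, hd, hL⟩ : Params)))) x⟫_ℝ := by
  unfold dotProduct
  rw [← Equiv.sum_comp (bondEK hj'), Complex.re_sum, inner_eq_sum]
  refine Finset.sum_congr rfl fun b _ => ?_
  rw [bondEK_apply, Pi.star_apply, TV_apply_EK, Complex.star_def, Complex.conj_ofReal, Complex.re_ofReal_mul, re_Lap_TV hj' x b]
  exact congrArg (fun t : ℝ => x b * t) (Lap_apply ((L : ℝ) ^ j) x b).symm

include hj' in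
/-- **THE QUADRATIC FORMS AGREE**: `⟨A, (∂*∂ + ∂∂*)A⟩ = ⟨A, Σ_ν∇_ν*∇_νA⟩` on the V1 bond space at `c = L^j`. [cite: Balaban1984PropagatorsI, (1.21) p.21] -/
theorem inner_lapV_eq (x : BondSpace (⟨d + 1, L, m, K, hd, hL⟩ : Params)) :
    ⟪x, (dcsE ((L : ℝ) ^ j) ∘ₗ dcE ((L : ℝ) ^ j) + dE ((L : ℝ) ^ j) ∘ₗ dsE ((L : ℝ) ^ j) :
        BondSpace (⟨d + 1, L, m, K, hd, hL⟩ : Params) →ₗ[ℝ] BondSpace (⟨d + 1, L, m, K, hd, hL⟩ : Params)) x⟫_ℝ =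
      ⟪x, (∑ ν : Fin (d + 1), ((((L : ℝ) ^ j) • (onE (LinearMap.funLeft ℝ ℝ (fun b : PBond (⟨d + 1, L, m, K, hd, hL⟩ : Params) 0 =>
          (⟨b.src.unshift ν, b.dir⟩ : PBond (⟨d + 1, L, m, K, hd, hL⟩ : Params) 0))) - LinearMap.id) :
            BondSpace (⟨d + 1, L, m, K, hd, hL⟩ : Params) →ₗ[ℝ] BondSpace (⟨d + 1, L, m, K, hd, hL⟩ : Params))) ∘ₗ
        ((((L : ℝ) ^ j) • (onE (LinearMap.funLeft ℝ ℝ (fun b : PBond (⟨d + 1, L, m, K, hd, hL⟩ : Params) 0 =>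
          (⟨b.src.shift ν, b.dir⟩ : PBond (⟨d + 1, L, m, K, hd, hL⟩ : Params) 0))) - LinearMap.id) :
            BondSpace (⟨d + 1, L, m, K, hd, hL⟩ : Params) →ₗ[ℝ] BondSpace (⟨d + 1, L, m, K, hd, hL⟩ : Params)))) x⟫_ℝ := by
  rw [← re_star_TV_Lap_TV hj', star_TV_Lap_TV hj', Complex.ofReal_re, lapV_form]

include hj' in
/-- **THE LATTICE WEITZENBÖCK IDENTITY `∂*∂ + ∂∂* = Σ_ν∇_ν*∇_ν` ON THE V1 BOND SPACE** ([4] (1.21) as an operator identity, at `c = L^j`): both sides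
are symmetric (`lapV_form`; `∇_ν*` is the adjoint of `∇_ν`, gen 15's `adjoint_Dop`) and their quadratic forms agree (`inner_lapV_eq`), so they are equal
(`LinearMap.IsSymmetric.inner_map_self_eq_zero` on the difference). [cite: Balaban1984PropagatorsI, (1.21) p.21; Balaban1984PropagatorsII, (2.19) p.226 («Δ = ∂*∂ + ∂∂*»)] -/
theorem lapV_eq_sum_DadjD :
    (dcsE ((L : ℝ) ^ j) ∘ₗ dcE ((L : ℝ) ^ j) + dE ((L : ℝ) ^ j) ∘ₗ dsE ((L : ℝ) ^ j) :
        BondSpace (⟨d + 1, L, m, K, hd, hL⟩ : Params) →ₗ[ℝ] BondSpace (⟨d + 1, L, m, K, hd, hL⟩ : Params)) =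
      ∑ ν : Fin (d + 1), ((((L : ℝ) ^ j) • (onE (LinearMap.funLeft ℝ ℝ (fun b : PBond (⟨d + 1, L, m, K, hd, hL⟩ : Params) 0 =>
          (⟨b.src.unshift ν, b.dir⟩ : PBond (⟨d + 1, L, m, K, hd, hL⟩ : Params) 0))) - LinearMap.id) :
            BondSpace (⟨d + 1, L, m, K, hd, hL⟩ : Params) →ₗ[ℝ] BondSpace (⟨d + 1, L, m, K, hd, hL⟩ : Params))) ∘ₗ
        ((((L : ℝ) ^ j) • (onE (LinearMap.funLeft ℝ ℝ (fun b : PBond (⟨d + 1, L, m, K, hd, hL⟩ : Params) 0 =>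
          (⟨b.src.shift ν, b.dir⟩ : PBond (⟨d + 1, L, m, K, hd, hL⟩ : Params) 0))) - LinearMap.id) :
            BondSpace (⟨d + 1, L, m, K, hd, hL⟩ : Params) →ₗ[ℝ] BondSpace (⟨d + 1, L, m, K, hd, hL⟩ : Params))) := by
  set A : BondSpace (⟨d + 1, L, m, K, hd, hL⟩ : Params) →ₗ[ℝ] BondSpace (⟨d + 1, L, m, K, hd, hL⟩ : Params) :=
    dcsE ((L : ℝ) ^ j) ∘ₗ dcE ((L : ℝ) ^ j) + dE ((L : ℝ) ^ j) ∘ₗ dsE ((L : ℝ) ^ j) with hA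
  set B : BondSpace (⟨d + 1, L, m, K, hd, hL⟩ : Params) →ₗ[ℝ] BondSpace (⟨d + 1, L, m, K, hd, hL⟩ : Params) :=
    ∑ ν : Fin (d + 1), ((((L : ℝ) ^ j) • (onE (LinearMap.funLeft ℝ ℝ (fun b : PBond (⟨d + 1, L, m, K, hd, hL⟩ : Params) 0 =>
          (⟨b.src.unshift ν, b.dir⟩ : PBond (⟨d + 1, L, m, K, hd, hL⟩ : Params) 0))) - LinearMap.id) :
            BondSpace (⟨d + 1, L, m, K, hd, hL⟩ : Params) →ₗ[ℝ] BondSpace (⟨d + 1, L, m, K, hd, hL⟩ : Params))) ∘ₗ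
        ((((L : ℝ) ^ j) • (onE (LinearMap.funLeft ℝ ℝ (fun b : PBond (⟨d + 1, L, m, K, hd, hL⟩ : Params) 0 =>
          (⟨b.src.shift ν, b.dir⟩ : PBond (⟨d + 1, L, m, K, hd, hL⟩ : Params) 0))) - LinearMap.id) :
            BondSpace (⟨d + 1, L, m, K, hd, hL⟩ : Params) →ₗ[ℝ] BondSpace (⟨d + 1, L, m, K, hd, hL⟩ : Params))) with hB
  -- symmetry of both operators
  have hAsymm : ∀ u v, ⟪A u, v⟫_ℝ = ⟪u, A v⟫_ℝ := by
    intro u v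
    rw [real_inner_comm, hA, lapV_form, lapV_form, real_inner_comm (dcE _ u), real_inner_comm (dsE _ u)]
  have hBsymm : ∀ u v, ⟪B u, v⟫_ℝ = ⟪u, B v⟫_ℝ := by
    intro u v
    rw [hB, LinearMap.sum_apply, LinearMap.sum_apply, sum_inner, inner_sum]
    refine Finset.sum_congr rfl fun ν _ => ?_
    rw [LinearMap.comp_apply, LinearMap.comp_apply, ← adjoint_Dop, LinearMap.adjoint_inner_left, LinearMap.adjoint_inner_right]
  have hS : (A - B).IsSymmetric := by
    intro u v
    rw [LinearMap.sub_apply, LinearMap.sub_apply, inner_sub_left, inner_sub_right, hAsymm, hBsymm]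
  have h0 : ∀ x, ⟪(A - B) x, x⟫_ℝ = 0 := by
    intro x
    rw [LinearMap.sub_apply, inner_sub_left, ← real_inner_comm (A x) x, ← real_inner_comm (B x) x, hA, hB, inner_lapV_eq hj', sub_self]
  exact sub_eq_zero.mp (hS.inner_map_self_eq_zero.mp h0)

end Weitzenbock

/-- **`Δ_□ = (tsV1 …).lapV = ∂*∂ + ∂∂*` OF THE MEMBER IS r03's CENSUS LAPLACIAN `Σ_λ∇_λ*∇_λ`** (`TSIdx.lapTS`) — the Weitzenböck identity for every
member of the two-scale family. [cite: Balaban1984PropagatorsII, (2.19) p.226, (2.90) p.239; Balaban1984PropagatorsI, (1.21) p.21] -/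
theorem lapV_member_eq_lapTS {d L : ℕ} {hd : 1 ≤ d + 1} {hL : Odd L ∧ 1 < L} {a₀ a₁ : ℝ} (i : TSIdx d L hd hL a₀ a₁) : i.D.lapV = i.lapTS := by
  haveI : NeZero L := ⟨by have := hL.2; omega⟩
  exact lapV_eq_sum_DadjD (d := d) (L := L) (m := i.m) (K := i.K) (hd := hd) (hL := hL) (Nat.le_of_succ_le i.hj)

/-! ## §2  Line 1 of (2.92): the Leibniz rule for `Σ_λ∇_λ*∇_λ` against a multiplication, on the bond functions of the member torus -/

section Leibniz

variable {d L : ℕ} {hd : 1 ≤ d + 1} {hL : Odd L ∧ 1 < L} {a₀ a₁ : ℝ}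

/-- **LINE 1 OF (2.92) — THE LEIBNIZ RULE**: for every member `i` and every real bond function `h`,
`h·(ΔA) − Δ(hA) = Σ_λ [(∇_λh)·(∇_λA) + (∇_λ*h)·(∇_λ*A)] − (Δh)·A` with `Δ = Σ_λ∇_λ*∇_λ = i.lapTS`, `∇_λ = i.Dl λ`, `∇_λ* = i.Dla λ` (factor `L^j`), in the
operator ring of the bond functions of the member torus (print's *"Σ_{b∈st(x)}(∂h_□)(b)(∂A_μ)(b) − (Δh_□)(x)A_μ(x)"*, the star `st(x)` written as the forward
and the backward bond of each direction; r03's `…B6Eq239Commutator.laplace_part` is the scalar-site twin). [cite: Balaban1984PropagatorsII, (2.92) p.239, (2.39) p.229] -/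
theorem leibniz_lapTS (i : TSIdx d L hd hL a₀ a₁) (h : PBond i.P 0 → ℝ) :
    mulOp h * onFun i.lapTS - onFun i.lapTS * mulOp h =
      ∑ lam : Fin i.P.d, (mulOp (onFun (i.Dl lam) h) * onFun (i.Dl lam) + mulOp (onFun (i.Dla lam) h) * onFun (i.Dla lam))
        - mulOp (onFun i.lapTS h) := by
  apply LinearMap.ext
  intro A
  funext b
  simp only [LinearMap.sub_apply, LinearMap.sum_apply, LinearMap.add_apply, Module.End.mul_apply, Finset.sum_apply, Pi.sub_apply,
    Pi.add_apply, mulOp_apply, onFun_apply, TSIdx.lapTS_apply, TSIdx.Dl_apply, TSIdx.Dla_apply]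
  rw [Finset.mul_sum, Finset.sum_mul, ← Finset.sum_sub_distrib, ← Finset.sum_sub_distrib]
  refine Finset.sum_congr rfl fun ν _ => ?_
  ring

end Leibniz

/-! ## §3  `hdec` for the member operator `Δ_□ + Q*aQ` of (2.90) -/

section Hdec

variable {d L : ℕ} {hd : 1 ≤ d + 1} {hL : Odd L ∧ 1 < L} {a₀ a₁ : ℝ}

/-- **`hdec` FOR THE GENUINE TWO-SCALE MEMBER** (the shape of the hypothesis `hdec` of p38's `ineq2134_diag_kLevel`/`h2134_kFam_kLevel`, on the member
torus, before r03's transplant): for every member `i` and every real bond function `h`,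
`h(Δ_□ + Q*aQ) − (Δ_□ + Q*aQ)h = (Σ_{e} cf_e·E_e − c₀) + Σ_{k∈{()}} z·(N h − h N)` with `E (λ,true) = ∇_λ`, `E (λ,false) = ∇_λ*`, `cf_e = E_e h`,
`c₀ = Δh` (line 1, `leibniz_lapTS` + §1), and line 2 kept as ONE commutator partner `N = Q*aQ`, `z ≡ −1`.
[cite: Balaban1984PropagatorsII, (2.92) p.239 (lines 1–2), (2.90) p.239] -/
theorem hdec_member (i : TSIdx d L hd hL a₀ a₁) (h : PBond i.P 0 → ℝ) :
    mulOp h * onFun (i.D.lapV + LinearMap.adjoint i.D.Q ∘ₗ i.D.a ∘ₗ i.D.Q) - onFun (i.D.lapV + LinearMap.adjoint i.D.Q ∘ₗ i.D.a ∘ₗ i.D.Q) * mulOp h =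
      (∑ e ∈ (Finset.univ : Finset (Fin i.P.d × Bool)),
          mulOp (onFun (if e.2 then i.Dl e.1 else i.Dla e.1) h) * onFun (if e.2 then i.Dl e.1 else i.Dla e.1) - mulOp (onFun i.lapTS h)) +
        ∑ _k ∈ ({()} : Finset Unit), mulOp (fun _ => (-1 : ℝ)) *
          (onFun (LinearMap.adjoint i.D.Q ∘ₗ i.D.a ∘ₗ i.D.Q) * mulOp h - mulOp h * onFun (LinearMap.adjoint i.D.Q ∘ₗ i.D.a ∘ₗ i.D.Q)) := by
  have hneg : ∀ T : Module.End ℝ (PBond i.P 0 → ℝ), mulOp (fun _ : PBond i.P 0 => (-1 : ℝ)) * T = -T := by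
    intro T
    apply LinearMap.ext
    intro v
    funext b
    simp [mulOp_apply]
  have hsum : (∑ e ∈ (Finset.univ : Finset (Fin i.P.d × Bool)),
      mulOp (onFun (if e.2 then i.Dl e.1 else i.Dla e.1) h) * onFun (if e.2 then i.Dl e.1 else i.Dla e.1) : Module.End ℝ (PBond i.P 0 → ℝ)) =
      ∑ lam : Fin i.P.d, (mulOp (onFun (i.Dl lam) h) * onFun (i.Dl lam) + mulOp (onFun (i.Dla lam) h) * onFun (i.Dla lam)) := by
    rw [Fintype.sum_prod_type]
    refine Finset.sum_congr rfl fun lam _ => ?_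
    rw [Fintype.sum_bool]
    simp only [Bool.false_eq_true, if_true, if_false]
  rw [lapV_member_eq_lapTS i, show onFun (i.lapTS + LinearMap.adjoint i.D.Q ∘ₗ i.D.a ∘ₗ i.D.Q) =
      onFun i.lapTS + onFun (LinearMap.adjoint i.D.Q ∘ₗ i.D.a ∘ₗ i.D.Q) from rfl, Finset.sum_singleton, hneg, hsum, ← leibniz_lapTS i h]
  noncomm_ring

/-- the same for the SCALED member operator `κ•(Δ_□ + Q*aQ)` (the unit factor `κ = (c′/L^j)²` of r03's transplant passes through: `cf`, `c₀`, `N` scale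
by `κ`). [cite: Balaban1984PropagatorsII, (2.92) p.239, (2.94) p.239 (rescaling)] -/
theorem hdec_member_smul (i : TSIdx d L hd hL a₀ a₁) (h : PBond i.P 0 → ℝ) (κ : ℝ) :
    mulOp h * (κ • onFun (i.D.lapV + LinearMap.adjoint i.D.Q ∘ₗ i.D.a ∘ₗ i.D.Q)) -
        (κ • onFun (i.D.lapV + LinearMap.adjoint i.D.Q ∘ₗ i.D.a ∘ₗ i.D.Q)) * mulOp h =
      (∑ e ∈ (Finset.univ : Finset (Fin i.P.d × Bool)),
          mulOp (κ • onFun (if e.2 then i.Dl e.1 else i.Dla e.1) h) * onFun (if e.2 then i.Dl e.1 else i.Dla e.1) - mulOp (κ • onFun i.lapTS h)) +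
        ∑ _k ∈ ({()} : Finset Unit), mulOp (fun _ => (-1 : ℝ)) *
          ((κ • onFun (LinearMap.adjoint i.D.Q ∘ₗ i.D.a ∘ₗ i.D.Q)) * mulOp h - mulOp h * (κ • onFun (LinearMap.adjoint i.D.Q ∘ₗ i.D.a ∘ₗ i.D.Q))) := by
  have hsm : ∀ (g : PBond i.P 0 → ℝ), (mulOp (κ • g) : Module.End ℝ (PBond i.P 0 → ℝ)) = κ • mulOp g := by
    intro g
    apply LinearMap.ext
    intro v
    funext b
    simp [mulOp_apply, mul_assoc]
  set T : Module.End ℝ (PBond i.P 0 → ℝ) := onFun (i.D.lapV + LinearMap.adjoint i.D.Q ∘ₗ i.D.a ∘ₗ i.D.Q) with hT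
  have e1 : mulOp h * (κ • T) - (κ • T) * mulOp h = κ • (mulOp h * T - T * mulOp h) := by
    simp only [smul_sub, mul_smul_comm, smul_mul_assoc]
  rw [e1, hT, hdec_member i h]
  simp only [smul_add, smul_sub, Finset.smul_sum, smul_mul_assoc, mul_smul_comm, hsm, mul_sub]

end Hdec

/-! ## §4  The backward-difference partner: `∇_λ*G_□` has the (2.133)₂ majorant on the member geometry -/

section Partners

variable {d L : ℕ} {hd : 1 ≤ d + 1} {hL : Odd L ∧ 1 < L} {a₀ a₁ : ℝ}

open Classical in
/-- **`∇_λ*∘G_□` HAS AN EXPONENTIALLY DECAYING BLOCK KERNEL, UNIFORMLY** (the backward twin of p22 gen 14's `blockBound_DG_scaling`):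
`∇_λ*X(b) = −(∇_λX)(b − e_λ)`, and the block of `b − e_λ` is within one unit step of the block of `b` (`torusDist_blk_unshift_le_one`), so the block
bound `(C, δ)` of `∇_λG_□` gives `(Ce^{δ}, δ)` for `∇_λ*G_□`. [cite: Balaban1984PropagatorsII, (2.133) p.247, (2.92) p.239 (line 1); Balaban1984PropagatorsI, (1.110) p.35] -/
theorem blockBound_DlaG_scaling (d L : ℕ) (hd : 1 ≤ d + 1) (hL : Odd L ∧ 1 < L) {a₀ a₁ : ℝ} (ha₀ : 0 < a₀) (ha₁ : a₀ ≤ a₁) :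
    ∃ δ : ℝ, 0 < δ ∧ ∃ C : ℝ, 0 ≤ C ∧ ∀ (i : TSIdx d L hd hL a₀ a₁) (lam : Fin i.P.d) (b : PBond i.P 0) (y : Site i.P i.j),
      ∑ b' ∈ univ.filter (fun b' : PBond i.P 0 => iterBlockOf i.j b'.src = y), |(i.Dla lam ∘ₗ i.D.G) (EuclideanSpace.single b' (1 : ℝ)) b| ≤
        C * Real.exp (-(δ * i.tdist (iterBlockOf i.j b.src) y)) := by
  obtain ⟨δ, hδ, C, hC, h⟩ := blockBound_DG_scaling d L hd hL ha₀ ha₁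
  refine ⟨δ, hδ, C * Real.exp δ, by positivity, fun i lam b y => ?_⟩
  have hj' : i.j ≤ i.P.m + i.P.K := Nat.le_of_succ_le i.hj
  -- `∇_λ*X(b) = −(L^j)(X(b) − X(b − e_λ)) = −(∇_λX)(b − e_λ)`
  have hentry : ∀ b' : PBond i.P 0, (i.Dla lam ∘ₗ i.D.G) (EuclideanSpace.single b' (1 : ℝ)) b =
      -((i.Dl lam ∘ₗ i.D.G) (EuclideanSpace.single b' (1 : ℝ)) ⟨b.src.unshift lam, b.dir⟩) := by
    intro b'
    rw [LinearMap.comp_apply, LinearMap.comp_apply, TSIdx.Dla_apply, TSIdx.Dl_apply]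
    rw [show (⟨(⟨b.src.unshift lam, b.dir⟩ : PBond i.P 0).src.shift lam, (⟨b.src.unshift lam, b.dir⟩ : PBond i.P 0).dir⟩ : PBond i.P 0) = b by
      rw [show (⟨b.src.unshift lam, b.dir⟩ : PBond i.P 0).src = b.src.unshift lam from rfl, B10StarCount.shift_unshift]]
    ring
  simp_rw [hentry, abs_neg]
  refine (h i.m i.K i.j i.hc i.hj i.Λ' i.w i.hw0 i.hw1 lam ⟨b.src.unshift lam, b.dir⟩ y).trans ?_
  rw [mul_assoc, ← Real.exp_add]
  refine mul_le_mul_of_nonneg_left (Real.exp_le_exp.2 ?_) hC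
  -- one fine step moves the block by at most one unit step
  have hstep : torusSupNorm (Mk i.P i.j) (rep (Mk i.P i.j) (iterBlockOf i.j (b.src.unshift lam)) - rep (Mk i.P i.j) (iterBlockOf i.j b.src)) ≤ 1 :=
    torusDist_blk_unshift_le_one hj' b.src lam
  have htri := (torusDist_isPseudoDist (Mk i.P i.j)).triangle (iterBlockOf i.j b.src) (iterBlockOf i.j (b.src.unshift lam)) y
  have hsy := (torusDist_isPseudoDist (Mk i.P i.j)).symm (iterBlockOf i.j b.src) (iterBlockOf i.j (b.src.unshift lam))
  have hstep' := hsy.le.trans hstep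
  show -(δ * i.tdist (iterBlockOf i.j (b.src.unshift lam)) y) ≤ δ + -(δ * i.tdist (iterBlockOf i.j b.src) y)
  unfold TSIdx.tdist
  have hm := mul_le_mul_of_nonneg_left (htri.trans (add_le_add hstep' le_rfl)) hδ.le
  linarith

/-- **THE BACKWARD-DIFFERENCE PARTNER OF LINE 1, MAJORANT SHAPE**: `onFun (∇_λ* ∘ G_□)` has the majorant `A·e^{−δ|y − y′|_T}` on `tsGeo i R M`, ONE
`(δ, A)` (on `d, L, a₀, a₁`) for all members and directions — the shape of the hypothesis `hEG` of the (2.134) files for `E = onFun ∇_λ*`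
(`onFun (∇_λ* ∘ G_□) = onFun ∇_λ* * onFun G_□`, r03's `onFun_comp`); the forward partner is p38's `…B6Ineq2133TwoScaleV1.ineq2133_DG`.
[cite: Balaban1984PropagatorsII, (2.133) p.247, (2.92) p.239] -/
theorem ineq2133_DlaG (d L : ℕ) (hd : 1 ≤ d + 1) (hL : Odd L ∧ 1 < L) {a₀ a₁ : ℝ} (ha₀ : 0 < a₀) (ha₁ : a₀ ≤ a₁) :
    ∃ δ : ℝ, 0 < δ ∧ ∃ A : ℝ, 0 ≤ A ∧ ∀ (i : TSIdx d L hd hL a₀ a₁) (R M : ℝ) (lam : Fin i.P.d),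
      HasMajorant (g := tsGeo i R M) (fun b : PBond i.P 0 => iterBlockOf i.j b.src) (onFun (i.Dla lam ∘ₗ i.D.G))
        (fun y y' => A * Real.exp (-(δ * i.tdist y y'))) := by
  obtain ⟨δ, hδ, C, hC, h⟩ := blockBound_DlaG_scaling d L hd hL ha₀ ha₁
  exact ⟨δ, hδ, C, hC, fun i R M lam => hasMajorant_of_blockBound i R M (i.Dla lam ∘ₗ i.D.G) fun b y => h i lam b y⟩

end Partners

/-! ## §5  The averaging partner `N = Q*aQ` of line 2: block bound and majorant on the member geometry -/

section QaQ

variable {d L m K : ℕ} {hd : 1 ≤ d + 1} {hL : Odd L ∧ 1 < L} {c : ℝ} (hc : c ≠ 0) {j : ℕ}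
  (Λ' : Finset (Site (⟨d + 1, L, m, K, hd, hL⟩ : Params) (j + 1))) {w : CIdx j Λ' → ℝ}
  [DecidableEq (PBond (⟨d + 1, L, m, K, hd, hL⟩ : Params) 0)] [DecidableEq (PBond (⟨d + 1, L, m, K, hd, hL⟩ : Params) j)] [DecidableEq (CIdx j Λ')]

omit [DecidableEq (PBond (⟨d + 1, L, m, K, hd, hL⟩ : Params) 0)] [DecidableEq (CIdx j Λ')] in
/-- the entries of the middle factor `aQ″` (unit bonds → indices): `(aQ″e_b)_i = w_i·q_i(b)`. [cite: Balaban1984PropagatorsII, (2.97) p.240, (2.119) p.243] -/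
theorem aQpp_single_apply (b : PBond (⟨d + 1, L, m, K, hd, hL⟩ : Params) j) (i : CIdx j Λ') :
    (aW (⟨d + 1, L, m, K, hd, hL⟩ : Params) j Λ' w ∘ₗ Qpp (⟨d + 1, L, m, K, hd, hL⟩ : Params) j Λ') (EuclideanSpace.single b (1 : ℝ)) i =
      w i * Qpp (⟨d + 1, L, m, K, hd, hL⟩ : Params) j Λ' (EuclideanSpace.single b (1 : ℝ)) i := by
  rw [LinearMap.comp_apply, aW_apply]

omit [DecidableEq (PBond (⟨d + 1, L, m, K, hd, hL⟩ : Params) 0)] in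
/-- **the entries of `aQ″` decay trivially at every rate**: `|w_i q_i(b)| ≤ W·e^{δ(2L−1)}·e^{−δ|p(i) − x_b|_T}` whenever `|w_i| ≤ W` (`q_i(b) ≤ 1`,
`q_i(b) ≠ 0 ⇒ |x_b − p(i)|_T ≤ 2L − 1`: gen 17's `Qpp_adjoint_entry_le`). [cite: Balaban1984PropagatorsII, (2.146) p.248, (2.119) p.243] -/
theorem abs_aQpp_entry_le (hj : j + 1 ≤ m + K) {W : ℝ} (hW : ∀ i, |w i| ≤ W) {δ : ℝ} (hδ : 0 ≤ δ) (i : CIdx j Λ') (b : PBond (⟨d + 1, L, m, K, hd, hL⟩ : Params) j) :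
    |(aW (⟨d + 1, L, m, K, hd, hL⟩ : Params) j Λ' w ∘ₗ Qpp (⟨d + 1, L, m, K, hd, hL⟩ : Params) j Λ') (EuclideanSpace.single b (1 : ℝ)) i| ≤
      W * Real.exp (δ * (2 * (L : ℝ) - 1)) * Real.exp (-(δ * torusSupNorm (Mk (⟨d + 1, L, m, K, hd, hL⟩ : Params) j) (rep (Mk (⟨d + 1, L, m, K, hd, hL⟩ : Params) j) ((Sum.elim (fun o : OutBond j Λ' => o.1.src)
          (fun b₁ : InBond j Λ' => Site.blockSite b₁.1.src (fun _ => ⟨0, Params.L_pos _⟩)) :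
            CIdx j Λ' → Site (⟨d + 1, L, m, K, hd, hL⟩ : Params) j) i) - rep (Mk (⟨d + 1, L, m, K, hd, hL⟩ : Params) j) b.src))) := by
  rw [aQpp_single_apply, abs_mul]
  have hq := Qpp_adjoint_entry_le Λ' hj hδ b i
  rw [adjoint_entry (Qpp (⟨d + 1, L, m, K, hd, hL⟩ : Params) j Λ') i b] at hq
  have hsy := (torusDist_isPseudoDist (Mk (⟨d + 1, L, m, K, hd, hL⟩ : Params) j)).symm b.src ((Sum.elim (fun o : OutBond j Λ' => o.1.src)
          (fun b₁ : InBond j Λ' => Site.blockSite b₁.1.src (fun _ => ⟨0, Params.L_pos _⟩)) :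
            CIdx j Λ' → Site (⟨d + 1, L, m, K, hd, hL⟩ : Params) j) i)
  have hW0 : 0 ≤ W := (abs_nonneg _).trans (hW i)
  calc |w i| * |Qpp (⟨d + 1, L, m, K, hd, hL⟩ : Params) j Λ' (EuclideanSpace.single b (1 : ℝ)) i|
      ≤ W * (Real.exp (δ * (2 * (L : ℝ) - 1)) * Real.exp (-(δ * torusSupNorm (Mk (⟨d + 1, L, m, K, hd, hL⟩ : Params) j) (rep (Mk (⟨d + 1, L, m, K, hd, hL⟩ : Params) j) b.src - rep (Mk (⟨d + 1, L, m, K, hd, hL⟩ : Params) j) ((Sum.elim (fun o : OutBond j Λ' => o.1.src)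
          (fun b₁ : InBond j Λ' => Site.blockSite b₁.1.src (fun _ => ⟨0, Params.L_pos _⟩)) :
            CIdx j Λ' → Site (⟨d + 1, L, m, K, hd, hL⟩ : Params) j) i))))) :=
        mul_le_mul (hW i) hq (abs_nonneg _) hW0
    _ = _ := by rw [hsy, mul_assoc]

omit [DecidableEq (PBond (⟨d + 1, L, m, K, hd, hL⟩ : Params) 0)] in
/-- **`aQ″` HAS THE BLOCK BOUND `(W·e^{δ(2L−1)}·(d+1), δ)` FOR EVERY `δ ≥ 0`** (indices ← unit bonds placed at their sources; `d + 1` bonds per source).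
[cite: Balaban1984PropagatorsII, (2.146) p.248, (2.150) p.249 (bookkeeping, ours)] -/
theorem blockBound_aQpp (hj : j + 1 ≤ m + K) {W : ℝ} (hW : ∀ i, |w i| ≤ W) {δ : ℝ} (hδ : 0 ≤ δ) (i : CIdx j Λ') (y : Site (⟨d + 1, L, m, K, hd, hL⟩ : Params) j) :
    ∑ b ∈ univ.filter (fun b : PBond (⟨d + 1, L, m, K, hd, hL⟩ : Params) j => b.src = y), |(aW (⟨d + 1, L, m, K, hd, hL⟩ : Params) j Λ' w ∘ₗ Qpp (⟨d + 1, L, m, K, hd, hL⟩ : Params) j Λ') (EuclideanSpace.single b (1 : ℝ)) i| ≤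
      W * Real.exp (δ * (2 * (L : ℝ) - 1)) * (1 * (d + 1) : ℕ) * Real.exp (-(δ * torusSupNorm (Mk (⟨d + 1, L, m, K, hd, hL⟩ : Params) j) (rep (Mk (⟨d + 1, L, m, K, hd, hL⟩ : Params) j) ((Sum.elim (fun o : OutBond j Λ' => o.1.src)
          (fun b₁ : InBond j Λ' => Site.blockSite b₁.1.src (fun _ => ⟨0, Params.L_pos _⟩)) :
            CIdx j Λ' → Site (⟨d + 1, L, m, K, hd, hL⟩ : Params) j) i) - rep (Mk (⟨d + 1, L, m, K, hd, hL⟩ : Params) j) y))) :=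
  blockBound_of_entry (ρ := fun t t' : Site (⟨d + 1, L, m, K, hd, hL⟩ : Params) j => torusSupNorm (Mk (⟨d + 1, L, m, K, hd, hL⟩ : Params) j) (rep (Mk (⟨d + 1, L, m, K, hd, hL⟩ : Params) j) t - rep (Mk (⟨d + 1, L, m, K, hd, hL⟩ : Params) j) t'))
    (aW (⟨d + 1, L, m, K, hd, hL⟩ : Params) j Λ' w ∘ₗ Qpp (⟨d + 1, L, m, K, hd, hL⟩ : Params) j Λ') (Sum.elim (fun o : OutBond j Λ' => o.1.src)
          (fun b₁ : InBond j Λ' => Site.blockSite b₁.1.src (fun _ => ⟨0, Params.L_pos _⟩)) :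
            CIdx j Λ' → Site (⟨d + 1, L, m, K, hd, hL⟩ : Params) j) (fun b : PBond (⟨d + 1, L, m, K, hd, hL⟩ : Params) j => b.src)
    (by have := (abs_nonneg _).trans (hW i); positivity) (card_fiber_src_le (P := (⟨d + 1, L, m, K, hd, hL⟩ : Params)) (j := j))
    (fun i b => abs_aQpp_entry_le Λ' hj hW hδ i b) i y

/-- **`Q*aQ = Q*·(aQ″)·Q_j` HAS A UNIFORM BLOCK BOUND AT EVERY RATE** (fine bonds ← fine bonds, blocks of `T^{(j)}`): gen 17's `Q*` at rate `δ + 1`,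
`aQ″` at rate `δ + 1` (above), gen 14's `Q_j` at rate `δ`, composed twice without volume factors (`blockBound_comp`).
[cite: Balaban1984PropagatorsII, (2.92) p.239 (line 2), (2.146) p.248, (2.150) p.249 (bookkeeping, ours)] -/
theorem blockBound_QaQ (hj : j + 1 ≤ m + K) {W : ℝ} (hW0 : 0 ≤ W) (hW : ∀ i, |w i| ≤ W) {δ : ℝ} (hδ : 0 ≤ δ) (b₀ : PBond (⟨d + 1, L, m, K, hd, hL⟩ : Params) 0) (y : Site (⟨d + 1, L, m, K, hd, hL⟩ : Params) j) :
    ∑ b₀' ∈ univ.filter (fun b₀' : PBond (⟨d + 1, L, m, K, hd, hL⟩ : Params) 0 => iterBlockOf j b₀'.src = y),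
        |(LinearMap.adjoint (tsV1 hc Λ' w).Q ∘ₗ (tsV1 hc Λ' w).a ∘ₗ (tsV1 hc Λ' w).Q) (EuclideanSpace.single b₀' (1 : ℝ)) b₀| ≤
      ((⟨d + 1, L, m, K, hd, hL⟩ : Params).eta j ^ (d + 1) * Real.exp (δ + 1 + 1) * (Real.exp ((δ + 1) * (2 * (L : ℝ) - 1)) * (2 * (d + 1) : ℕ)) *
          latticeConst (d + 1) 1) *
        (W * Real.exp ((δ + 1) * (2 * (L : ℝ) - 1)) * (1 * (d + 1) : ℕ) * Real.exp δ * latticeConst (d + 1) ((δ + 1) - δ)) *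
        latticeConst (d + 1) ((δ + 1) - δ) *
        Real.exp (-(δ * torusSupNorm (Mk (⟨d + 1, L, m, K, hd, hL⟩ : Params) j) (rep (Mk (⟨d + 1, L, m, K, hd, hL⟩ : Params) j) (iterBlockOf j b₀.src) - rep (Mk (⟨d + 1, L, m, K, hd, hL⟩ : Params) j) y))) := by
  have hjP : j ≤ (⟨d + 1, L, m, K, hd, hL⟩ : Params).m + (⟨d + 1, L, m, K, hd, hL⟩ : Params).K := Nat.le_of_succ_le hj
  have hK1 : 0 ≤ latticeConst (d + 1) 1 := latticeConst_nonneg _ zero_le_one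
  have hK2 : 0 ≤ latticeConst (d + 1) ((δ + 1) - δ) := latticeConst_nonneg _ (by linarith)
  have hρ := torusDist_isPseudoDist (Mk (⟨d + 1, L, m, K, hd, hL⟩ : Params) j)
  have hK := torusDist_sumBound (Mk (⟨d + 1, L, m, K, hd, hL⟩ : Params) j)
  have hη : 0 ≤ (⟨d + 1, L, m, K, hd, hL⟩ : Params).eta j ^ (d + 1) := pow_nonneg (pow_nonneg (inv_nonneg.mpr (Nat.cast_nonneg _)) _) _
  -- the inner composite `(aQ″)∘Q_j` : fine bonds → indices, rate `δ`
  have hA := blockBound_comp (KY := fun a => latticeConst (d + 1) a) hρ hK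
    (aW (⟨d + 1, L, m, K, hd, hL⟩ : Params) j Λ' w ∘ₗ Qpp (⟨d + 1, L, m, K, hd, hL⟩ : Params) j Λ') (tsV1 hc Λ' w).Qv (Sum.elim (fun o : OutBond j Λ' => o.1.src)
          (fun b₁ : InBond j Λ' => Site.blockSite b₁.1.src (fun _ => ⟨0, Params.L_pos _⟩)) :
            CIdx j Λ' → Site (⟨d + 1, L, m, K, hd, hL⟩ : Params) j)
    (fun b : PBond (⟨d + 1, L, m, K, hd, hL⟩ : Params) j => b.src) (fun b₀' : PBond (⟨d + 1, L, m, K, hd, hL⟩ : Params) 0 => iterBlockOf j b₀'.src)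
    (Cf := W * Real.exp ((δ + 1) * (2 * (L : ℝ) - 1)) * (1 * (d + 1) : ℕ)) (Cg := Real.exp δ) (a := δ + 1) (b := δ) (δ' := δ)
    (by positivity) (by positivity) hδ le_rfl (by linarith)
    (fun i y' => blockBound_aQpp Λ' hj hW (by linarith : (0 : ℝ) ≤ δ + 1) i y')
    (fun b y' => blockBound_Qv hc hjP Λ' w hδ b y')
  -- the outer composite `Q* ∘ ((aQ″)∘Q_j)`
  have hB := blockBound_comp (KY := fun a => latticeConst (d + 1) a) hρ hK
    (LinearMap.adjoint (tsV1 hc Λ' w).Q) ((aW (⟨d + 1, L, m, K, hd, hL⟩ : Params) j Λ' w ∘ₗ Qpp (⟨d + 1, L, m, K, hd, hL⟩ : Params) j Λ') ∘ₗ (tsV1 hc Λ' w).Qv)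
    (fun b₀ : PBond (⟨d + 1, L, m, K, hd, hL⟩ : Params) 0 => iterBlockOf j b₀.src) (Sum.elim (fun o : OutBond j Λ' => o.1.src)
          (fun b₁ : InBond j Λ' => Site.blockSite b₁.1.src (fun _ => ⟨0, Params.L_pos _⟩)) :
            CIdx j Λ' → Site (⟨d + 1, L, m, K, hd, hL⟩ : Params) j) (fun b₀' : PBond (⟨d + 1, L, m, K, hd, hL⟩ : Params) 0 => iterBlockOf j b₀'.src)
    (Cf := (⟨d + 1, L, m, K, hd, hL⟩ : Params).eta j ^ (d + 1) * Real.exp (δ + 1 + 1) * (Real.exp ((δ + 1) * (2 * (L : ℝ) - 1)) * (2 * (d + 1) : ℕ)) *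
          latticeConst (d + 1) 1)
    (Cg := W * Real.exp ((δ + 1) * (2 * (L : ℝ) - 1)) * (1 * (d + 1) : ℕ) * Real.exp δ * latticeConst (d + 1) ((δ + 1) - δ))
    (a := δ + 1) (b := δ) (δ' := δ)
    (by positivity) (by positivity) hδ le_rfl (by linarith)
    (fun b₀ y' => blockBound_Q_adjoint hc Λ' hj (by linarith : (0 : ℝ) ≤ δ + 1) b₀ y') hA b₀ y
  have e : (tsV1 hc Λ' w).a ∘ₗ (tsV1 hc Λ' w).Q =
      (aW (⟨d + 1, L, m, K, hd, hL⟩ : Params) j Λ' w ∘ₗ Qpp (⟨d + 1, L, m, K, hd, hL⟩ : Params) j Λ') ∘ₗ (tsV1 hc Λ' w).Qv := by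
    rw [LinearMap.comp_assoc]
    rfl
  rw [e]
  exact hB

end QaQ

section QaQMember

variable {d L : ℕ} {hd : 1 ≤ d + 1} {hL : Odd L ∧ 1 < L} {a₀ a₁ : ℝ}

open Classical in
/-- **`N = Q*aQ` OF THE MEMBER HAS AN EXPONENTIALLY DECAYING BLOCK KERNEL, UNIFORMLY IN THE FAMILY**: ONE rate (`δ = 1`) and ONE constant
(on `d, L, a₁`; the weights `a₀n^{d+1} ≤ w ≤ a₁n^{d+1}` against `Q*`'s `η^{d+1}`: `η^{d+1}n^{d+1} = 1`) for every member, every fine bond and block.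
[cite: Balaban1984PropagatorsII, (2.92) p.239 (line 2), (2.90) p.239, (2.150) p.249 (bookkeeping, ours)] -/
theorem blockBound_QaQ_scaling (d L : ℕ) (hd : 1 ≤ d + 1) (hL : Odd L ∧ 1 < L) {a₀ a₁ : ℝ} (ha₀ : 0 < a₀) :
    ∃ δ : ℝ, 0 < δ ∧ ∃ C : ℝ, 0 ≤ C ∧ ∀ (i : TSIdx d L hd hL a₀ a₁) (b : PBond i.P 0) (y : Site i.P i.j),
      ∑ b' ∈ univ.filter (fun b' : PBond i.P 0 => iterBlockOf i.j b'.src = y),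
          |(LinearMap.adjoint i.D.Q ∘ₗ i.D.a ∘ₗ i.D.Q) (EuclideanSpace.single b' (1 : ℝ)) b| ≤
        C * Real.exp (-(δ * i.tdist (iterBlockOf i.j b.src) y)) := by
  have hLpos : (0 : ℝ) < L := by have := hL.2; positivity
  refine ⟨1, one_pos, (Real.exp (1 + 1 + 1) * (Real.exp ((1 + 1) * (2 * (L : ℝ) - 1)) * (2 * (d + 1) : ℕ)) * latticeConst (d + 1) 1) *
      (|a₁| * Real.exp ((1 + 1) * (2 * (L : ℝ) - 1)) * (1 * (d + 1) : ℕ) * Real.exp 1 * latticeConst (d + 1) ((1 + 1) - 1)) *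
      latticeConst (d + 1) ((1 + 1) - 1),
    by
      have := latticeConst_nonneg (d + 1) zero_le_one
      have := latticeConst_nonneg (d + 1) (by norm_num : (0 : ℝ) ≤ (1 + 1) - 1)
      positivity, fun i b y => ?_⟩
  have hW : ∀ c, |i.w c| ≤ |a₁| * ((L : ℝ) ^ i.j) ^ (d + 1) := by
    intro c
    have h0 : 0 < a₀ * ((L : ℝ) ^ i.j) ^ (d + 1) := by positivity
    rw [abs_of_pos (h0.trans_le (i.hw0 c))]
    exact (i.hw1 c).trans (mul_le_mul_of_nonneg_right (le_abs_self a₁) (by positivity))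
  have h := blockBound_QaQ i.hc i.Λ' (w := i.w) i.hj (by positivity) hW (le_of_lt one_pos) b y
  have hL0 : (L : ℝ) ≠ 0 := hLpos.ne'
  refine h.trans (le_of_eq ?_)
  unfold TSIdx.tdist
  simp only [Params.eta, inv_pow]
  field_simp

/-- **THE AVERAGING PARTNER OF LINE 2, MAJORANT SHAPE**: `N = onFun (Q*aQ)` of the member has the majorant `A·e^{−δ|y − y′|_T}` on `tsGeo i R M`, ONE
`(δ, A)` (on `d, L, a₁`) for all members — the shape of the hypothesis `hN` of the (2.134) files for the single partner `N` of `hdec_member`.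
[cite: Balaban1984PropagatorsII, (2.92) p.239 (line 2), (2.134) p.247] -/
theorem ineq2133_QaQ (d L : ℕ) (hd : 1 ≤ d + 1) (hL : Odd L ∧ 1 < L) {a₀ a₁ : ℝ} (ha₀ : 0 < a₀) :
    ∃ δ : ℝ, 0 < δ ∧ ∃ A : ℝ, 0 ≤ A ∧ ∀ (i : TSIdx d L hd hL a₀ a₁) (R M : ℝ),
      HasMajorant (g := tsGeo i R M) (fun b : PBond i.P 0 => iterBlockOf i.j b.src) (onFun (LinearMap.adjoint i.D.Q ∘ₗ i.D.a ∘ₗ i.D.Q))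
        (fun y y' => A * Real.exp (-(δ * i.tdist y y'))) := by
  obtain ⟨δ, hδ, C, hC, h⟩ := blockBound_QaQ_scaling d L hd hL (a₁ := a₁) ha₀
  exact ⟨δ, hδ, C, hC, fun i R M => hasMajorant_of_blockBound i R M _ fun b y => h i b y⟩

end QaQMember

end Literature.MathematicalPhysics.QuantumFieldTheory.Balaban1983to89.B6Eq292MemberTwoScaleV1

end
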